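import Literature.Analysis.FluidPDE.NSBoundedMildWeightedPicard
import Literature.Analysis.FluidPDE.OseenDuhamelUnitScale
import Literature.Analysis.FluidPDE.OseenDuhamelRescale
import HarnessLib

/-!
# KNSS 2009, §4: the weighted bilinear estimate (discharge of `WeightedBilinearEstimate`)

Analysis/FluidPDE proof file (everything proved, no definitions) discharging the named fact
`Literature.Analysis.FluidPDE.WeightedBilinearEstimate` of `NSBoundedMildWeightedPicard.lean`
(Koch–Nadirashvili–Seregin–Šverák, Acta Math. 203 (2009) = arXiv:0709.3599, §4 p. 8: "The key is
an estimate of `B` with the same form as [`‖B(u,v)‖_∞ ≤ C√T‖u‖_∞‖v‖_∞`, (4.4)] but in spaces with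
norms given by the expression on the left-hand side of (4.5)"): for every order `N` there is
`A ≥ 0` such that for `ν > 0`, `T > 0` and weighted-smooth fields `v`, `w` on `(0, T) × E`, the
Duhamel term `B^ν_0(v, w) = oseenDuhamel ν 0 v w` is weighted-smooth there, and scale-invariant
bounds `C_v`, `C_w` of orders `≤ N` for `v`, `w` give the bound `A √(T/ν) C_v C_w` of orders `≤ N`
for `B^ν_0(v, w)` (`WeightedBilinearEstimate_holds`).

## Proof

The source gives one sentence; the proof supplied here is the standard one (Giga–Inui–Matsui
1999 for `L^∞` data; KNSS 2009, Prop. 4.1 and Remark 4.2), organised around the parabolic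
rescaling of `ParabolicRescale.lean`:

* **Scale invariance** (`OseenDuhamelRescale.lean`, KNSS 2009, §1 (1.3)): the rescaling of
  `B^ν_0(v, w)` at scale `t₀` is `√(t₀/ν) B^1_0(ṽ, w̃)` with `ṽ(θ, η) = v(t₀θ, √(νt₀)η)` the
  rescaled field (`parabolicRescale_oseenDuhamel_eq_smul`); the rescaled fields are jointly `C^∞`
  on `(0, T/t₀) × E`, `T/t₀ > 1`, bounded by the order-zero weighted bound, with derivatives of
  orders `≤ N` bounded by `4^N C_v` at heights in `[1/4, 1]`
  (`HasWeightedBound.norm_iteratedFDeriv_le`) and every derivative bounded at heights in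
  `[1/4, T/t₀)` (`IsWeightedSmooth.exists_norm_iteratedFDeriv_le`).
* **Unit scale** (`OseenDuhamelUnitScale.lean`): `B^1_0(ṽ, w̃)` is jointly `C^∞` on
  `(1/2, min (T/t₀) 2) × E` and `‖D^m B^1_0(ṽ, w̃)(1, ξ)‖ ≤ A_N (4^N C_v)(4^N C_w)`, `m ≤ N` — the
  far part with the derivatives on the kernel (`OseenDuhamelFar.lean`, the kernel bounds
  (3.5)–(3.6) to all orders), the near part with the derivatives on the smoothly cut-off fields
  (`OseenDuhamelNearSmooth.lean`).
* Hence `B^ν_0(v, w)` is jointly `C^∞` on the slab (`contDiffOn_uncurry_of_parabolicRescale`) with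
  `‖D^m [parabolicRescale ν t₀ B^ν_0(v,w)](1, ξ)‖ ≤ 16^N A_N √(t₀/ν) C_v C_w ≤ 16^N A_N √(T/ν) C_v C_w`.

## References

* G. Koch, N. Nadirashvili, G. Seregin, V. Šverák, *Liouville theorems for the Navier–Stokes
  equations and applications*, Acta Math. 203 (2009) = arXiv:0709.3599, §1 (1.3), §4 p. 8:
  (4.3)–(4.5), Prop. 4.1, Remark 4.2. [KochNadirashviliSereginSverak2009]
* Y. Giga, K. Inui, S. Matsui, *On the Cauchy problem for the Navier–Stokes equations with
  nondecaying initial data*, Quad. Mat. 4 (1999).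
-/

noncomputable section

open MeasureTheory Set Function Filter Metric Real
open _root_.Topology
open scoped ENNReal NNReal ContDiff

namespace Literature.Analysis.FluidPDE

variable {E : Type*} [NormedAddCommGroup E] [InnerProductSpace ℝ E] [FiniteDimensional ℝ E]
  [MeasurableSpace E] [BorelSpace E]

/-! ### The rescaled fields -/

section Rescaled

variable {ν T t₀ C : ℝ} {N : ℕ} {v w : ℝ → E → E}

omit [NormedAddCommGroup E] [InnerProductSpace ℝ E] [FiniteDimensional ℝ E] [MeasurableSpace E]
  [BorelSpace E] in
/-- A scale `t₀ ∈ (0, T)` sees the slab up to the height `T/t₀ > 1`. [folklore] -/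
theorem one_lt_div_of_mem_Ioo_scale (ht₀ : t₀ ∈ Ioo 0 T) : 1 < T / t₀ :=
  (one_lt_div ht₀.1).2 ht₀.2

omit [NormedAddCommGroup E] [InnerProductSpace ℝ E] [FiniteDimensional ℝ E] [MeasurableSpace E]
  [BorelSpace E] in
/-- Heights below `T/t₀` are times below `T`. [folklore] -/
theorem mul_lt_of_lt_div_scale (ht₀ : 0 < t₀) {θ : ℝ} (hθ : θ < T / t₀) : t₀ * θ < T := by
  have h := (lt_div_iff₀ ht₀).1 hθ
  rwa [mul_comm] at h

omit [FiniteDimensional ℝ E] [MeasurableSpace E] [BorelSpace E] in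
/-- The rescaled field `ṽ = curry (parabolicRescale ν t₀ v)` is jointly `C^∞` on
`(0, T/t₀) × E`. [folklore] -/
theorem IsWeightedSmooth.contDiffOn_uncurry_curry_parabolicRescale (hv : IsWeightedSmooth ν T v)
    (ht₀ : 0 < t₀) :
    ContDiffOn ℝ ∞ (uncurry (curry (parabolicRescale ν t₀ v))) (Ioo 0 (T / t₀) ×ˢ univ) := by
  rw [Function.uncurry_curry]
  exact hv.contDiffOn_parabolicRescale ht₀

omit [FiniteDimensional ℝ E] [MeasurableSpace E] [BorelSpace E] in
/-- Every derivative of the rescaled field is bounded at heights in `[1/4, T/t₀)`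
(`IsWeightedSmooth.exists_norm_iteratedFDeriv_le`). [folklore] -/
theorem IsWeightedSmooth.exists_norm_iteratedFDeriv_curry_parabolicRescale_le
    (hv : IsWeightedSmooth ν T v) (hν : 0 < ν) (ht₀ : 0 < t₀) (i : ℕ) :
    ∃ C : ℝ, ∀ r ∈ Ico (1 / 4 : ℝ) (T / t₀) ×ˢ (univ : Set E),
      ‖iteratedFDeriv ℝ i (uncurry (curry (parabolicRescale ν t₀ v))) r‖ ≤ C := by
  rw [Function.uncurry_curry]
  obtain ⟨C, -, hC⟩ := hv.exists_norm_iteratedFDeriv_le hν i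
  refine ⟨C, fun r hr => ?_⟩
  obtain ⟨hr1, -⟩ := mem_prod.1 hr
  exact hC ht₀ hr1.1 (mul_lt_of_lt_div_scale ht₀ hr1.2) r.2

omit [FiniteDimensional ℝ E] [MeasurableSpace E] [BorelSpace E] in
/-- The rescaled field is bounded on `(0, T/t₀) × E` by the weighted bound (order zero,
`HasWeightedBound.norm_le`). [folklore] -/
theorem HasWeightedBound.norm_curry_parabolicRescale_le (hb : HasWeightedBound ν T N v C)
    (hν : 0 < ν) (ht₀ : 0 < t₀) :
    ∀ θ ∈ Ioo 0 (T / t₀), ∀ y : E, ‖curry (parabolicRescale ν t₀ v) θ y‖ ≤ C := by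
  intro θ hθ y
  have ht : t₀ * θ ∈ Ioo 0 T := ⟨mul_pos ht₀ hθ.1, mul_lt_of_lt_div_scale ht₀ hθ.2⟩
  exact hb.norm_le hν ht (Real.sqrt (ν * t₀) • y)

omit [FiniteDimensional ℝ E] [MeasurableSpace E] [BorelSpace E] in
/-- The derivatives of orders `≤ N` of the rescaled field are bounded by `4^N C` at heights in
`[1/4, 1]` (`HasWeightedBound.norm_iteratedFDeriv_le`; `t₀ θ' ≤ t₀ < T`). [folklore] -/
theorem HasWeightedBound.norm_iteratedFDeriv_curry_parabolicRescale_le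
    (hb : HasWeightedBound ν T N v C) (hν : 0 < ν) (hT : 0 < T) (ht₀ : t₀ ∈ Ioo 0 T) :
    ∀ i ≤ N, ∀ r ∈ Icc (1 / 4 : ℝ) 1 ×ˢ (univ : Set E),
      ‖iteratedFDeriv ℝ i (uncurry (curry (parabolicRescale ν t₀ v))) r‖ ≤ 4 ^ N * C := by
  haveI : Nonempty E := ⟨0⟩
  have hC : 0 ≤ C := hb.nonneg hT
  rw [Function.uncurry_curry]
  intro i hi r hr
  obtain ⟨hr1, -⟩ := mem_prod.1 hr
  have hlt : t₀ * r.1 < T :=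
    calc t₀ * r.1 ≤ t₀ * 1 := mul_le_mul_of_nonneg_left hr1.2 ht₀.1.le
      _ = t₀ := mul_one _
      _ < T := ht₀.2
  refine (hb.norm_iteratedFDeriv_le hν ht₀.1 hr1.1 hlt hi r.2).trans ?_
  exact mul_le_mul_of_nonneg_right (pow_le_pow_right₀ (by norm_num) hi) hC

/-- **The rescaling of the Duhamel term is a multiple of the unit-scale Duhamel term of the
rescaled fields** (`oseenDuhamel_parabolicRescale`, as an identity of functions):
`parabolicRescale ν t₀ (B^ν_0(v, w)) = √(t₀/ν) • B^1_0(ṽ, w̃)`. KNSS 2009, §1 (1.3).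
[cite: KochNadirashviliSereginSverak2009, §1 (1.3) and §4 p. 8 (arXiv:0709.3599)] -/
theorem parabolicRescale_oseenDuhamel_eq_smul (hν : 0 < ν) (ht₀ : 0 < t₀) (v w : ℝ → E → E) :
    parabolicRescale ν t₀ (oseenDuhamel ν 0 v w) =
      Real.sqrt (t₀ / ν) • uncurry (oseenDuhamel 1 0 (curry (parabolicRescale ν t₀ v))
        (curry (parabolicRescale ν t₀ w))) := by
  funext p
  rw [Pi.smul_apply]
  exact oseenDuhamel_parabolicRescale hν ht₀ v w p

/-- **The unit-scale Duhamel term of the rescaled fields is jointly `C^∞` near unit height**,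
on `(1/2, min (T/t₀) 2) × E` (`contDiffOn_oseenDuhamel_one`). [folklore] -/
theorem IsWeightedSmooth.contDiffOn_oseenDuhamel_one_rescaled (hv : IsWeightedSmooth ν T v)
    (hw : IsWeightedSmooth ν T w) (hν : 0 < ν) (ht₀ : t₀ ∈ Ioo 0 T) :
    ContDiffOn ℝ ∞ (uncurry (oseenDuhamel 1 0 (curry (parabolicRescale ν t₀ v))
        (curry (parabolicRescale ν t₀ w)))) (Ioo (1 / 2 : ℝ) (min (T / t₀) 2) ×ˢ univ) := by
  obtain ⟨Mv, hMv0, hMv⟩ := hv.exists_hasWeightedBound 0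
  obtain ⟨Mw, hMw0, hMw⟩ := hw.exists_hasWeightedBound 0
  exact contDiffOn_oseenDuhamel_one (one_lt_div_of_mem_Ioo_scale ht₀)
    (hv.contDiffOn_uncurry_curry_parabolicRescale ht₀.1)
    (hw.contDiffOn_uncurry_curry_parabolicRescale ht₀.1)
    (hv.exists_norm_iteratedFDeriv_curry_parabolicRescale_le hν ht₀.1)
    (hw.exists_norm_iteratedFDeriv_curry_parabolicRescale_le hν ht₀.1) hMv0 hMw0
    (hMv.norm_curry_parabolicRescale_le hν ht₀.1) (hMw.norm_curry_parabolicRescale_le hν ht₀.1)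

/-- **The rescalings of the Duhamel term are jointly `C^∞` near unit height.** [folklore] -/
theorem IsWeightedSmooth.contDiffOn_parabolicRescale_oseenDuhamel (hv : IsWeightedSmooth ν T v)
    (hw : IsWeightedSmooth ν T w) (hν : 0 < ν) (ht₀ : t₀ ∈ Ioo 0 T) :
    ContDiffOn ℝ ∞ (parabolicRescale ν t₀ (oseenDuhamel ν 0 v w))
      (Ioo (1 / 2 : ℝ) (min (T / t₀) 2) ×ˢ univ) := by
  rw [parabolicRescale_oseenDuhamel_eq_smul hν ht₀.1]
  exact (hv.contDiffOn_oseenDuhamel_one_rescaled hw hν ht₀).const_smul _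

end Rescaled

/-! ### The estimate at every scale -/

section Estimate

/-- **The weighted bilinear bound at every scale**: for every `N` there is `A = A(N, E) ≥ 0`
with `‖D^m [parabolicRescale ν t₀ B^ν_0(v,w)](1, ξ)‖ ≤ A √(T/ν) C_v C_w` for all scales
`t₀ ∈ (0, T)`, orders `m ≤ N` and points `ξ`, whenever `v`, `w` are weighted-smooth on
`(0, T) × E` with scale-invariant bounds `C_v`, `C_w` of orders `≤ N` (the unit-scale estimate
`exists_norm_iteratedFDeriv_oseenDuhamel_one_le` transported by
`parabolicRescale_oseenDuhamel_eq_smul`, `√(t₀/ν) ≤ √(T/ν)`). KNSS 2009, §4 p. 8: the estimate of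
`B` in the weighted norms (4.5). [cite: KochNadirashviliSereginSverak2009, §4 (4.4)–(4.5) and Prop. 4.1 (arXiv:0709.3599 p. 8)] -/
theorem exists_norm_iteratedFDeriv_parabolicRescale_oseenDuhamel_le (N : ℕ) :
    ∃ A : ℝ, 0 ≤ A ∧ ∀ {ν T : ℝ} {v w : ℝ → E → E} {Cv Cw : ℝ}, 0 < ν → 0 < T →
      IsWeightedSmooth ν T v → IsWeightedSmooth ν T w →
      HasWeightedBound ν T N v Cv → HasWeightedBound ν T N w Cw →
      ∀ t₀ ∈ Ioo 0 T, ∀ m ≤ N, ∀ ξ : E,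
        ‖iteratedFDeriv ℝ m (parabolicRescale ν t₀ (oseenDuhamel ν 0 v w)) (1, ξ)‖ ≤
          A * Real.sqrt (T / ν) * Cv * Cw := by
  obtain ⟨A, hA0, hA⟩ := exists_norm_iteratedFDeriv_oseenDuhamel_one_le (E := E) N
  refine ⟨A * 4 ^ N * 4 ^ N, by positivity, ?_⟩
  intro ν T v w Cv Cw hν hT hv hw hbv hbw t₀ ht₀ m hm ξ
  haveI : Nonempty E := ⟨0⟩
  have hCv : 0 ≤ Cv := hbv.nonneg hT
  have hCw : 0 ≤ Cw := hbw.nonneg hT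
  have hT' : 1 < T / t₀ := one_lt_div_of_mem_Ioo_scale ht₀
  have h4 : (1 : ℝ) ≤ 4 ^ N := one_le_pow₀ (by norm_num)
  have h1 := hA hT' (hv.contDiffOn_uncurry_curry_parabolicRescale ht₀.1)
    (hw.contDiffOn_uncurry_curry_parabolicRescale ht₀.1)
    (hv.exists_norm_iteratedFDeriv_curry_parabolicRescale_le hν ht₀.1)
    (hw.exists_norm_iteratedFDeriv_curry_parabolicRescale_le hν ht₀.1) hCv hCw
    (hbv.norm_curry_parabolicRescale_le hν ht₀.1) (hbw.norm_curry_parabolicRescale_le hν ht₀.1)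
    (le_mul_of_one_le_left hCv h4) (le_mul_of_one_le_left hCw h4)
    (hbv.norm_iteratedFDeriv_curry_parabolicRescale_le hν hT ht₀)
    (hbw.norm_iteratedFDeriv_curry_parabolicRescale_le hν hT ht₀) m hm ξ
  -- smoothness at `(1, ξ)`
  have hS := hv.contDiffOn_oseenDuhamel_one_rescaled hw hν ht₀
  have hmem : ((1 : ℝ), ξ) ∈ Ioo (1 / 2 : ℝ) (min (T / t₀) 2) ×ˢ (univ : Set E) :=
    mk_mem_prod ⟨by norm_num, lt_min hT' (by norm_num)⟩ (mem_univ _)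
  have hAt := (hS.contDiffAt ((isOpen_Ioo.prod isOpen_univ).mem_nhds hmem)).of_le
    (show ((m : ℕ∞) : WithTop ℕ∞) ≤ ((⊤ : ℕ∞) : WithTop ℕ∞) by exact_mod_cast le_top)
  rw [parabolicRescale_oseenDuhamel_eq_smul hν ht₀.1, iteratedFDeriv_const_smul_apply hAt, norm_smul,
    Real.norm_of_nonneg (Real.sqrt_nonneg _)]
  have hsq : Real.sqrt (t₀ / ν) ≤ Real.sqrt (T / ν) :=
    Real.sqrt_le_sqrt (div_le_div_of_nonneg_right ht₀.2.le hν.le)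
  calc Real.sqrt (t₀ / ν) * ‖iteratedFDeriv ℝ m (uncurry (oseenDuhamel 1 0
          (curry (parabolicRescale ν t₀ v)) (curry (parabolicRescale ν t₀ w)))) (1, ξ)‖
      ≤ Real.sqrt (T / ν) * (A * (4 ^ N * Cv) * (4 ^ N * Cw)) :=
        mul_le_mul hsq h1 (norm_nonneg _) (Real.sqrt_nonneg _)
    _ = A * 4 ^ N * 4 ^ N * Real.sqrt (T / ν) * Cv * Cw := by ring

/-- **The Duhamel term of weighted-smooth fields is weighted-smooth** (KNSS 2009, Prop. 4.1:
all the weighted derivatives of `B(u, u)` exist and are bounded). [cite: KochNadirashviliSereginSverak2009, §4 Prop. 4.1 (arXiv:0709.3599 p. 8)] -/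
theorem IsWeightedSmooth.oseenDuhamel {ν T : ℝ} {v w : ℝ → E → E} (hv : IsWeightedSmooth ν T v)
    (hw : IsWeightedSmooth ν T w) (hν : 0 < ν) (hT : 0 < T) :
    IsWeightedSmooth ν T (oseenDuhamel ν 0 v w) := by
  refine ⟨?_, fun m => ?_⟩
  · refine contDiffOn_uncurry_of_parabolicRescale hν fun t₀ ht₀ =>
      ⟨1 / 2, min (T / t₀) 2, by norm_num, lt_min (one_lt_div_of_mem_Ioo_scale ht₀) (by norm_num), ?_⟩
    exact hv.contDiffOn_parabolicRescale_oseenDuhamel hw hν ht₀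
  · obtain ⟨A, -, hA⟩ := exists_norm_iteratedFDeriv_parabolicRescale_oseenDuhamel_le (E := E) m
    obtain ⟨Cv, -, hCv⟩ := hv.exists_hasWeightedBound m
    obtain ⟨Cw, -, hCw⟩ := hw.exists_hasWeightedBound m
    exact ⟨A * Real.sqrt (T / ν) * Cv * Cw, fun t₀ ht₀ ξ => hA hν hT hv hw hCv hCw t₀ ht₀ m le_rfl ξ⟩

/-- **KNSS 2009, §4: the weighted bilinear estimate** (discharge of
`Literature.Analysis.FluidPDE.WeightedBilinearEstimate`): for every order `N` there is `A ≥ 0`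
such that for `ν > 0`, `T > 0` and weighted-smooth fields `v`, `w` on `(0, T) × E`, the Duhamel
term `B^ν_0(v, w)` is weighted-smooth there, and scale-invariant bounds `C_v`, `C_w` of orders
`≤ N` for `v`, `w` give the bound `A √(T/ν) C_v C_w` of orders `≤ N` for `B^ν_0(v, w)` — "an
estimate of `B` with the same form as (4.4) but in spaces with norms given by the expression on
the left-hand side of (4.5)". [cite: KochNadirashviliSereginSverak2009, §4 (4.4)–(4.5) and Prop. 4.1 (arXiv:0709.3599 p. 8)] -/
theorem WeightedBilinearEstimate_holds : WeightedBilinearEstimate E := by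
  intro N
  obtain ⟨A, hA0, hA⟩ := exists_norm_iteratedFDeriv_parabolicRescale_oseenDuhamel_le (E := E) N
  refine ⟨A, hA0, ?_⟩
  intro ν T hν hT v w hv hw
  refine ⟨hv.oseenDuhamel hw hν hT, fun Cv Cw hbv hbw => ?_⟩
  intro t₀ ht₀ m hm ξ
  exact hA hν hT hv hw hbv hbw t₀ ht₀ m hm ξ

end Estimate

end Literature.Analysis.FluidPDE

end
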